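import Summits.NavierStokesRegularity.NavierStokesRegularity.Theorems.CriticalSwirlRegularity.Negative.SelfSimilarMomentumCalculus
import Literature.Analysis.FluidPDE.PeriodicCylinderFrameInversion

/-!
# The typed flat swirl gauge block carries no maximum principle for its momentum

Negative-side support for the crux `CriticalSwirlRegularity` (stmt-NavierStokesRegularity-1253, route
`FlatSwirlGauge`), line `registered` (birth skeleton `Cruxes/CriticalSwirlRegularity/Lines/birth.lean`), by the
line lead (continuation c2, 2026-08-17). Theorems only (no definitions).

The route's rendering advertises "flat connection ⇒ maximum principle for `α`" (module docstring of
`Theses/FlatSwirlGauge.lean`; the `FlatGaugeExcludesTypeI` sketch even uses "maximum principle for `α`, `α = 0`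
forced on the degeneracy set"). For the TYPED object `Literature.Analysis.FluidPDE.IsFlatSwirlGaugeOn` this is
false already on the rest state `u ≡ 0`: the transport law `(∂ₜ + u·∇)α = ν(Δα + ⟪b,∇α⟫)` and the drift bound
`‖b‖ d ≤ C₀` are asserted only where `d > 0`, and nothing ties the momentum to the degeneracy set `{d = 0}`.
So an admissible critical drift pointing INTO the axis can feed a momentum maximum sitting ON the axis, where no
clause applies, and that maximum grows.

Witness (`growingMomentum_isFlatSwirlGaugeOn`): vertex `x₀ = 0`, any `ν > 0`, `0 < ρ`, `ρ² < T`,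
* momentum `α(t,x) = (ρ² + νt)(4ρ² − ‖x‖²)` — a polynomial, `0 ≤ α ≤ 4ρ²(ρ² + νT)` on the cylinder, whose spatial
  maximum over `B_ρ(0)` is attained at the vertex and equals `4ρ²(ρ² + νt)`, STRICTLY INCREASING in `t`;
* degeneracy function `d = r = cylRadius` (distance to the `x₂`-axis; tube estimate
  `volume_cylRadius_lt_inter_ball_le`: `vol({r<δ} ∩ B(y,s)) ≤ 8δ²s`, so the witness is even LOCALLY 1-thin);
* drift `b(t,x) = −(E/(2(ρ²+νt)‖x‖²)) x`, `E = (4ρ² − ‖x‖²) + 6(ρ² + νt) > 0`, radial and inward, with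
  `‖b‖ r ≤ E/(2(ρ²+νt)) ≤ 5`: since `∂ₜα = ν(4ρ² − ‖x‖²)`, `∇α = −2(ρ²+νt)x`, `Δα = −6(ρ²+νt)`, the law
  `∂ₜα = ν(Δα + ⟪b,∇α⟫)` holds at every `x ≠ 0`, in particular wherever `r > 0`;
* constants `C₀ = 8`, `M = 4ρ²(ρ² + νT)`; the vorticity clauses are trivial (`curl 0 = 0`).

Consequences recorded below: the value `α(s,0)` at the vertex at a later time `s` strictly exceeds EVERY value
`α(t,y)`, `y ∈ ℝ³`, at any earlier admissible time `t` (`growingMomentum_lt_vertex_later`) and every lateral value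
`α(τ,y)`, `τ ≤ s`, `0 < ‖y‖ ≤ 2ρ` (`growingMomentum_lateral_lt_vertex`); hence the weak parabolic maximum
principle "a constant dominating `α` on the parabolic boundary of `[t,s] × B̄_{ρ'}(x₀)` dominates `α(s,·)` on
`B̄_{ρ'}(x₀)`" FAILS in the typed class (`weakMaximumPrinciple_false_of_isFlatSwirlGaugeOn`).

Information for the planners. The clause that restores the maximum principle and is TRUE in the exactly-flat
model is the Dirichlet clause `d(t,x) ≤ 0 → α(t,x) = 0` (`Γ = r u_θ` vanishes on the axis): with it a positive
interior maximum lies in `{d > 0}`, where `∇α = 0` and the law give `∂ₜα = νΔα ≤ 0`. Requiring the law on the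
closure instead is NOT compatible with the anchor (`Γ ≈ a r²` near the axis has `ΔΓ = 4a ≠ 0 = (∂ₜ + u·∇)Γ` there;
cf. the hypothesis `cylRadius x ≠ 0` in `IsClassicalNSSolutionOn.deriv_swirl_transport`). Together with
`MomentumUniformContinuityFalse` (no a-priori modulus even under local thinness) this is the second typed defect of
the v0 block found on this crux; both disappear in the exactly-flat model for STRUCTURAL reasons the block does not
record (Dirichlet trace on the axis; divergence-form drift `b = −2∇log r`).
-/

noncomputable section

namespace Summit.NavierStokesRegularity.NavierStokesRegularity.Theorems.CriticalSwirlRegularity.Negative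

open MeasureTheory Filter Set Metric Real InnerProductSpace
open scoped RealInnerProductSpace Laplacian
open Literature.Analysis.FluidPDE

/-! ### Calculus of the quadratic momentum slice `x ↦ c (a − ‖x‖²)` -/

/-- `∂ᵥ (c(a − ‖x‖²)) = −2c ⟪x, v⟫`. [folklore] -/
theorem fderiv_quadMomentum_apply (c a : ℝ) (x v : EuclideanSpace ℝ (Fin 3)) :
    fderiv ℝ (fun y : EuclideanSpace ℝ (Fin 3) => c * (a - ‖y‖ ^ 2)) x v = -(2 * c) * ⟪x, v⟫ := by
  have hg : HasDerivAt (fun σ : ℝ => c * (a - σ)) (-c) (‖x‖ ^ 2) := by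
    simpa using ((hasDerivAt_id (‖x‖ ^ 2)).const_sub a).const_mul c
  rw [fderiv_comp_norm_sq_apply (g := fun σ => c * (a - σ)) hg v]
  ring

/-- `∇ (c(a − ‖x‖²)) = −2c x`. [folklore] -/
theorem gradient_quadMomentum (c a : ℝ) (x : EuclideanSpace ℝ (Fin 3)) :
    gradient (fun y : EuclideanSpace ℝ (Fin 3) => c * (a - ‖y‖ ^ 2)) x = (-(2 * c)) • x := by
  refine ext_inner_right ℝ fun v => ?_
  rw [inner_gradient_left, fderiv_quadMomentum_apply, real_inner_smul_left]

/-- `Δ (c(a − ‖x‖²)) = −6c` on `ℝ³`. [folklore] -/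
theorem laplacian_quadMomentum (c a : ℝ) (x : EuclideanSpace ℝ (Fin 3)) :
    (Δ (fun y : EuclideanSpace ℝ (Fin 3) => c * (a - ‖y‖ ^ 2))) x = -(6 * c) := by
  have hg : ∀ σ ∈ (Set.univ : Set ℝ), HasDerivAt (fun σ : ℝ => c * (a - σ)) ((fun _ : ℝ => -c) σ) σ :=
    fun σ _ => by simpa using ((hasDerivAt_id σ).const_sub a).const_mul c
  have hg₁ : HasDerivAt (fun _ : ℝ => -c) 0 (‖x‖ ^ 2) := hasDerivAt_const _ _
  rw [laplacian_comp_norm_sq (g := fun σ => c * (a - σ)) isOpen_univ hg (Set.mem_univ _) hg₁,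
    finrank_euclideanSpace_fin]
  push_cast
  ring

/-- `∂ₜ ((ρ² + νt)(4ρ² − ‖x‖²)) = ν(4ρ² − ‖x‖²)`. [folklore] -/
theorem hasDerivAt_growingMomentum_time (ν ρ t : ℝ) (x : EuclideanSpace ℝ (Fin 3)) :
    HasDerivAt (fun s : ℝ => (ρ ^ 2 + ν * s) * (4 * ρ ^ 2 - ‖x‖ ^ 2)) (ν * (4 * ρ ^ 2 - ‖x‖ ^ 2)) t := by
  simpa using (((hasDerivAt_id t).const_mul ν).const_add (ρ ^ 2)).mul_const (4 * ρ ^ 2 - ‖x‖ ^ 2)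

/-- The growing momentum `(t,x) ↦ (ρ² + νt)(4ρ² − ‖x‖²)` is `C²` (indeed polynomial). [folklore] -/
theorem contDiff_growingMomentum (ν ρ : ℝ) :
    ContDiff ℝ 2 (Function.uncurry fun (t : ℝ) (x : EuclideanSpace ℝ (Fin 3)) =>
      (ρ ^ 2 + ν * t) * (4 * ρ ^ 2 - ‖x‖ ^ 2)) :=
  (contDiff_const.add (contDiff_const.mul contDiff_fst)).mul
    (contDiff_const.sub ((contDiff_norm_sq ℝ).comp contDiff_snd))

/-! ### The witness: an admissible rest-state gauge whose momentum maximum grows on the axis -/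

/-- **The witness.** On the rest state `u ≡ 0` (any `ν > 0`, `0 < ρ`, `ρ² < T`, vertex `x₀ = 0`) the polynomial
momentum `α(t,x) = (ρ² + νt)(4ρ² − ‖x‖²)`, the inward radial drift `b = −(E/(2(ρ²+νt)‖x‖²)) x` with
`E = (4ρ² − ‖x‖²) + 6(ρ²+νt)`, and the degeneracy function `d = cylRadius` satisfy every clause of the typed flat
swirl gauge block `IsFlatSwirlGaugeOn` with `C₀ = 8`, `M = 4ρ²(ρ² + νT)` (module docstring for the computation;
`‖b‖ r ≤ 5`). [folklore] -/
theorem growingMomentum_isFlatSwirlGaugeOn {ν T ρ : ℝ} (hν : 0 < ν) (hρ : 0 < ρ) (hρT : ρ ^ 2 < T) :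
    IsFlatSwirlGaugeOn ν 0 T 0 ρ 8 (4 * ρ ^ 2 * (ρ ^ 2 + ν * T))
      (fun t x => (ρ ^ 2 + ν * t) * (4 * ρ ^ 2 - ‖x‖ ^ 2))
      (fun t x => (-(((4 * ρ ^ 2 - ‖x‖ ^ 2) + 6 * (ρ ^ 2 + ν * t)) /
        (2 * (ρ ^ 2 + ν * t) * ‖x‖ ^ 2))) • x)
      (fun _ x => cylRadius x) := by
  refine ⟨hρ, hρT, (contDiff_growingMomentum ν ρ).contDiffOn,
    fun t _ δ hδ => volume_cylRadius_lt_inter_ball_le 0 ρ hδ.1.le, fun t ht x hx => ?_⟩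
  dsimp only [Pi.zero_apply]
  rw [Set.mem_Ioo] at ht
  rw [Metric.mem_ball, dist_zero_right] at hx
  have hρ2 : 0 < ρ ^ 2 := by positivity
  have ht0 : 0 < t := by linarith
  have hνt : 0 ≤ ν * t := by positivity
  set c := ρ ^ 2 + ν * t with hc
  have hc0 : 0 < c := by positivity
  have hcρ : ρ ^ 2 ≤ c := by linarith
  have hcT : c ≤ ρ ^ 2 + ν * T := by nlinarith [ht.2]
  have hx2 : ‖x‖ ^ 2 < ρ ^ 2 := by nlinarith [norm_nonneg x]
  have hq0 : 0 ≤ 4 * ρ ^ 2 - ‖x‖ ^ 2 := by nlinarith [norm_nonneg x]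
  have hq4 : 4 * ρ ^ 2 - ‖x‖ ^ 2 ≤ 4 * ρ ^ 2 := by nlinarith [norm_nonneg x]
  refine ⟨?_, ?_, fun hr => ⟨?_, ?_, ?_⟩⟩
  · -- `|α| ≤ M`
    rw [abs_of_nonneg (mul_nonneg hc0.le hq0)]
    calc c * (4 * ρ ^ 2 - ‖x‖ ^ 2) ≤ c * (4 * ρ ^ 2) := mul_le_mul_of_nonneg_left hq4 hc0.le
      _ ≤ (ρ ^ 2 + ν * T) * (4 * ρ ^ 2) := mul_le_mul_of_nonneg_right hcT (by positivity)
      _ = 4 * ρ ^ 2 * (ρ ^ 2 + ν * T) := by ring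
  · -- the vorticity of the rest state vanishes
    rw [curl_zero, inner_zero_left]
  · rw [curl_zero, norm_zero, zero_mul]
    positivity
  · -- the drift bound `‖b‖ r ≤ 5 ≤ 8`
    have hxpos : 0 < ‖x‖ := lt_of_lt_of_le hr (cylRadius_le_norm x)
    have hE0 : 0 < 4 * ρ ^ 2 - ‖x‖ ^ 2 + 6 * c := by positivity
    have hE10 : 4 * ρ ^ 2 - ‖x‖ ^ 2 + 6 * c ≤ 10 * c := by nlinarith [norm_nonneg x]
    rw [norm_smul, norm_neg, Real.norm_eq_abs, abs_of_pos (by positivity)]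
    calc (4 * ρ ^ 2 - ‖x‖ ^ 2 + 6 * c) / (2 * c * ‖x‖ ^ 2) * ‖x‖ * cylRadius x
        ≤ (4 * ρ ^ 2 - ‖x‖ ^ 2 + 6 * c) / (2 * c * ‖x‖ ^ 2) * ‖x‖ * ‖x‖ := by
          gcongr
          exact cylRadius_le_norm x
      _ = (4 * ρ ^ 2 - ‖x‖ ^ 2 + 6 * c) / (2 * c) := by
          field_simp
      _ ≤ 8 := by
          rw [div_le_iff₀ (by positivity)]
          nlinarith
  · -- the flat transport law at `x ≠ 0`
    have hxpos : 0 < ‖x‖ := lt_of_lt_of_le hr (cylRadius_le_norm x)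
    rw [(hasDerivAt_growingMomentum_time ν ρ t x).deriv, convect_zero_field, add_zero,
      laplacian_quadMomentum, gradient_quadMomentum, real_inner_smul_left, real_inner_smul_right,
      real_inner_self_eq_norm_sq]
    have hcx : (2 * c * ‖x‖ ^ 2) ≠ 0 := by positivity
    field_simp
    ring

/-! ### The momentum maximum sits at the vertex and grows -/

/-- The spatial maximum of the growing momentum at an admissible time is at the vertex:
`α(t,y) ≤ α(t,0) = 4ρ²(ρ² + νt)` for every `y`. [folklore] -/
theorem growingMomentum_le_vertex {ν ρ t : ℝ} (hc : 0 ≤ ρ ^ 2 + ν * t) (y : EuclideanSpace ℝ (Fin 3)) :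
    (ρ ^ 2 + ν * t) * (4 * ρ ^ 2 - ‖y‖ ^ 2) ≤
      (ρ ^ 2 + ν * t) * (4 * ρ ^ 2 - ‖(0 : EuclideanSpace ℝ (Fin 3))‖ ^ 2) := by
  rw [norm_zero]
  exact mul_le_mul_of_nonneg_left (by nlinarith [norm_nonneg y]) hc

/-- **The vertex value grows**: for `ν > 0`, `ρ ≠ 0` and `t < s`, `α(t,0) < α(s,0)`. [folklore] -/
theorem growingMomentum_vertex_strictMono {ν ρ t s : ℝ} (hν : 0 < ν) (hρ : 0 < ρ) (hts : t < s) :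
    (ρ ^ 2 + ν * t) * (4 * ρ ^ 2 - ‖(0 : EuclideanSpace ℝ (Fin 3))‖ ^ 2) <
      (ρ ^ 2 + ν * s) * (4 * ρ ^ 2 - ‖(0 : EuclideanSpace ℝ (Fin 3))‖ ^ 2) := by
  rw [norm_zero]
  have hρ2 : 0 < ρ ^ 2 := by positivity
  nlinarith [mul_lt_mul_of_pos_left hts hν]

/-- **Every earlier value is beaten by the later vertex value**: `α(t,y) < α(s,0)` for all `y ∈ ℝ³`
whenever `0 ≤ ρ² + νt` and `t < s` (`ν > 0`, `ρ > 0`). [folklore] -/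
theorem growingMomentum_lt_vertex_later {ν ρ t s : ℝ} (hν : 0 < ν) (hρ : 0 < ρ)
    (hc : 0 ≤ ρ ^ 2 + ν * t) (hts : t < s) (y : EuclideanSpace ℝ (Fin 3)) :
    (ρ ^ 2 + ν * t) * (4 * ρ ^ 2 - ‖y‖ ^ 2) <
      (ρ ^ 2 + ν * s) * (4 * ρ ^ 2 - ‖(0 : EuclideanSpace ℝ (Fin 3))‖ ^ 2) :=
  (growingMomentum_le_vertex hc y).trans_lt (growingMomentum_vertex_strictMono hν hρ hts)

/-- **Lateral values are beaten too**: for `τ ≤ s`, `0 < ρ² + ντ` and `0 < ‖y‖ ≤ 2ρ`,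
`α(τ,y) < α(s,0)`. [folklore] -/
theorem growingMomentum_lateral_lt_vertex {ν ρ τ s : ℝ} (hν : 0 < ν) (hρ : 0 < ρ)
    (hc : 0 < ρ ^ 2 + ν * τ) (hτs : τ ≤ s) {y : EuclideanSpace ℝ (Fin 3)} (hy0 : y ≠ 0)
    (hy : ‖y‖ ≤ 2 * ρ) :
    (ρ ^ 2 + ν * τ) * (4 * ρ ^ 2 - ‖y‖ ^ 2) <
      (ρ ^ 2 + ν * s) * (4 * ρ ^ 2 - ‖(0 : EuclideanSpace ℝ (Fin 3))‖ ^ 2) := by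
  rw [norm_zero]
  have hρ2 : 0 < ρ ^ 2 := by positivity
  have hyp : 0 < ‖y‖ := norm_pos_iff.2 hy0
  have hy2 : 0 < ‖y‖ ^ 2 := by positivity
  have hq0 : 0 ≤ 4 * ρ ^ 2 - ‖y‖ ^ 2 := by nlinarith [norm_nonneg y]
  have hcs : ρ ^ 2 + ν * τ ≤ ρ ^ 2 + ν * s := by nlinarith
  have hcs0 : 0 < ρ ^ 2 + ν * s := by linarith
  calc (ρ ^ 2 + ν * τ) * (4 * ρ ^ 2 - ‖y‖ ^ 2) ≤ (ρ ^ 2 + ν * s) * (4 * ρ ^ 2 - ‖y‖ ^ 2) :=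
        mul_le_mul_of_nonneg_right hcs hq0
    _ < (ρ ^ 2 + ν * s) * (4 * ρ ^ 2 - (0 : ℝ) ^ 2) := by nlinarith

/-! ### Hence: no weak maximum principle for the momentum of a typed flat swirl gauge -/

/-- **The weak parabolic maximum principle fails for momenta of typed flat swirl gauges** (already on the rest
state, `ν > 0`): it is NOT true that for every `IsFlatSwirlGaugeOn ν u T x₀ ρ C₀ M α b d`, every sub-cylinder
`[t,s] × B̄_{ρ'}(x₀)` (`T − ρ² < t ≤ s < T`, `0 < ρ' < ρ`) and every constant `K` dominating `α(t,·)` on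
`B̄_{ρ'}(x₀)` and `α` on `[t,s] × ∂B_{ρ'}(x₀)`, the constant `K` dominates `α(s,·)` on `B̄_{ρ'}(x₀)`. Witness:
`growingMomentum_isFlatSwirlGaugeOn` with `ν = 1`, `T = 2`, `ρ = 1`, `t = 3/2`, `s = 7/4`, `ρ' = 1/2`,
`K = 165/16`, where `α(s,0) = 11 > K`. The missing clause is the Dirichlet trace `d ≤ 0 → α = 0` (module
docstring). [folklore] -/
theorem weakMaximumPrinciple_false_of_isFlatSwirlGaugeOn :
    ¬ (∀ (ν : ℝ) (u : ℝ → EuclideanSpace ℝ (Fin 3) → EuclideanSpace ℝ (Fin 3)) (T : ℝ)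
        (x₀ : EuclideanSpace ℝ (Fin 3)) (ρ C₀ M : ℝ) (α : ℝ → EuclideanSpace ℝ (Fin 3) → ℝ)
        (b : ℝ → EuclideanSpace ℝ (Fin 3) → EuclideanSpace ℝ (Fin 3)) (d : ℝ → EuclideanSpace ℝ (Fin 3) → ℝ),
        IsFlatSwirlGaugeOn ν u T x₀ ρ C₀ M α b d → 0 < ν →
        ∀ (t s ρ' K : ℝ), T - ρ ^ 2 < t → t ≤ s → s < T → 0 < ρ' → ρ' < ρ →
          (∀ y ∈ Metric.closedBall x₀ ρ', α t y ≤ K) →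
          (∀ τ ∈ Set.Icc t s, ∀ y ∈ Metric.sphere x₀ ρ', α τ y ≤ K) →
          ∀ x ∈ Metric.closedBall x₀ ρ', α s x ≤ K) := by
  intro H
  have hG := growingMomentum_isFlatSwirlGaugeOn (ν := 1) (T := 2) (ρ := 1) one_pos one_pos (by norm_num)
  have h := H 1 0 2 0 1 8 (4 * 1 ^ 2 * (1 ^ 2 + 1 * 2)) _ _ _ hG one_pos (3 / 2) (7 / 4) (1 / 2) (165 / 16)
    (by norm_num) (by norm_num) (by norm_num) (by norm_num) (by norm_num)
    (fun y _ => by nlinarith [norm_nonneg y])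
    (fun τ hτ y hy => by
      rw [Set.mem_Icc] at hτ
      rw [mem_sphere_zero_iff_norm] at hy
      rw [hy]
      nlinarith)
    0 (Metric.mem_closedBall_self (by norm_num))
  rw [norm_zero] at h
  norm_num at h

end Summit.NavierStokesRegularity.NavierStokesRegularity.Theorems.CriticalSwirlRegularity.Negative
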